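import Literature.AlgebraicGeometry.AbelianSchemes.AbelianSchemeLDeltaFibreH1Vanishing
import Literature.AlgebraicGeometry.Motives.AbelianVarietyH0SqEqCardKThetaAnyField
import Literature.AlgebraicGeometry.Motives.AbelianVarietyPolarizationTypeAnalytic
import Literature.AlgebraicGeometry.AbelianSchemes.PolarizationLamFinrank
import Literature.AlgebraicGeometry.AbelianSchemes.SymplecticLiftOfIsogenyWeil
import Literature.AlgebraicGeometry.AbelianSchemes.AbelianSchemeOverFibreDim
import Literature.AlgebraicGeometry.Motives.AbelianVarietyTorsionPointsCountProofs
import HarnessLib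

/-!
# The RANK of `L^Δ(λ)^{⊗m}` on the fibres of a polarised abelian scheme of type `δ`: `h⁰ = (2m)^g · ∏ δᵢ`
# ([MumfordFogartyKirwan1994] Ch. 6 §2 Prop. 6.13; [MumfordAV1970] §16), the F-6 (VI) assembler's `hrank`

Layer `Literature/AlgebraicGeometry/AbelianSchemes`, namespace `Literature.AlgebraicGeometry.AbelianSchemes.AbelianSchemeOver`.
THEOREMS ONLY (no definition, no named fact, no instance, no notation, no `sorry`).  Cell `hodgecm-mathlib` (D-0151), F-DAG F-2 (b) RANK
brick, road (a) of record (B-plan1 (g16) 07:48:31Z; census `B-provers/B-p05/g17/CENSUS-F2b-Rank.B-p05g17.md` §3 (R3); B-p11 (g17)),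
file 3/3 — the CONSUMER FORM for B-p04 (g20)'s F-6 (VI) assembler (★ `Morphisms/SectionsRankOfFibreVanishing.rankAtStalk_secMod_top_eq_of_forall_prime`,
binder `hrank : ∀ 𝔭, finrank Γ(Spec κ(𝔭), 𝒪) (SecMod ((pullback (iX 𝔭)).obj G) (f₀ 𝔭)♯ ⊤) = r`) at `G = L^Δ(λ)^{⊗m}`, `r = (2m)^g ∏ δᵢ`
(`m = 3`: `6^g ∏ δᵢ` = [MumfordFogartyKirwan1994] Prop. 6.13 (ii) / the `m + 1` of Def. 7.3), over bases of characteristic `0`.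
Companion of ★ V4 `AbelianSchemes/AbelianSchemeLDeltaFibreH1Vanishing` (the `hvan` binder).  HC_CM is proved only modulo the 7
printed citations until rung 0 closes; nothing here bears on a summit statement.

Inputs BY NAME: ★ V4 §1 `detClass_restrict_LDelta_eq_cechClass_add_pullback_neg` (`[ι_s̄^*L^Δ(λ)] = [Θ + (−1)^*Θ]`), ★
`phiPic_detClass_restrict_LDelta` (`φ_{ι^*L^Δ} = φ_Θ²`), ★ `Polarization.mem_kerPointsAt_iff_mem_KTheta` (`K(Θ) = ker λ̄` on `Ω`-points), ★
`Polarization.natCard_kerPointsAt_eq_of_hasType` (`#ker λ̄ = (∏ δᵢ)²`), ★ `pow_surjective_of_cast_ne_zero` + ★ `natCard_torsionPoints_eq_of_charZero`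
(`[n]` onto on `Ω`-points with kernel of order `n^{2g}`), ★ `dim_fibre_of_isOfRelDim`, ★ (R3 2/3) `h0_sq_eq_natCard_KTheta_of_isAlgClosed`
(«`h⁰(Θ)² = #K(Θ)`», [MumfordAV1970] §16 transported from `ℂ`), ★ `CartierDivisor.finrank_secMod_lineBundle_eq_h0`, ★ p765502
`Modules.finrank_secMod_top_eq_of_isPullback_specMap` (flat base change of `H⁰` along `κ → κ̄`).

* §1 `nonempty_iso_restrict_LDelta_tensorPow_lineBundle_nsmul` — `ι_s̄^*L^Δ(λ)^{⊗m} ≅ 𝒪(m (Θ + (−1)^*Θ))` for THE `Θ` with `λ̄ = Λ(𝒪(Θ))`;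
  **`natCard_KTheta_nsmul_symm_eq`** — `#K(m (Θ + (−1)^*Θ)) = ((2m)^g ∏ δᵢ)²` (`K(m Θ_sym) = [2m]⁻¹ K(Θ)`, `φ` multiplicative).
* §2 **`Polarization.finrank_secMod_restrict_LDelta_tensorPow`** — at a geometric point of characteristic `0`:
  `dim_Ω Γ(A_s̄, ι_s̄^*L^Δ(λ)^{⊗m}) = (2m)^g ∏ δᵢ` (field scalars), `…'` (scalars `Γ(Spec Ω, 𝒪)`).
* §3 **`Polarization.finrank_secMod_pullback_LDelta_tensorPow (pol) (hg : A.IsOfRelDim g) (hT : pol.HasType δ) (Gr) (hGr₁) (hGr₂)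
  {κ} [Field κ] [CharZero κ] (t : Spec κ ⟶ S) (H : IsPullback iX f₀ A.X.hom t) (hm : 0 < m) :
  finrank Γ(Spec κ, 𝒪) (SecMod ((pullback iX).obj (tensorPow (Gr^*𝒫) m)) f₀♯ ⊤) = (2m)^g * polarizationDegree δ`** — EVERY field-valued
  point, ANY cartesian presentation of the fibre (the `hrank` binder verbatim): the geometric fibre over `κ̄` maps to `X₀` by a cartesian
  square over `Spec κ̄ → Spec κ` (pasting), §2 upstairs, flat base change of `H⁰` down.

## References
* [MumfordFogartyKirwan1994] D. Mumford, J. Fogarty, F. Kirwan, *Geometric Invariant Theory*, 3rd ed. (1994), Ch. 6 §2 Prop. 6.10 (p. 121),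
  Prop. 6.13 (p. 123); App. 7A (pp. 234–235).
* [MumfordAV1970] D. Mumford, *Abelian Varieties*, TIFR Studies in Mathematics 5 (1970), §6 Application 3 (p. 64), §16 (the Riemann–Roch
  theorem), §23 (the type of a polarisation).
* [GortzWedhorn2023] U. Görtz, T. Wedhorn, *Algebraic Geometry II: Cohomology of Schemes* (2023), Cor. 22.91 (p. 278).
-/

noncomputable section

set_option backward.isDefEq.respectTransparency false

open CategoryTheory CategoryTheory.Limits AlgebraicGeometry MonoidalCategory CartesianMonoidalCategory Function
open CategoryTheory.Abelian
open scoped MonObj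

namespace Literature.AlgebraicGeometry.AbelianSchemes

open Literature.AlgebraicGeometry.Motives Literature.AlgebraicGeometry.Modules
  Literature.AlgebraicGeometry.AbelianVarieties Literature.AlgebraicGeometry.Morphisms
open Literature.AlgebraicGeometry.ModuliOfAbelianVarieties (IsPolarizationType polarizationDegree)

namespace AbelianSchemeOver

/-! ## §0 Group theory: the preimage of a subgroup under a surjective endomorphism -/

/-- `#f⁻¹(H) = #ker f · #H` for a surjective homomorphism `f : G → G'` and a subgroup `H ≤ G'`. [folklore] -/
private theorem natCard_comap_eq_mul {G G' : Type*} [Group G] [Group G'] (f : G →* G') (hf : Surjective f) (H : Subgroup G') :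
    Nat.card (H.comap f) = Nat.card f.ker * Nat.card H := by
  let φ : H.comap f →* H := f.subgroupComap H
  have hφ : Surjective φ := by
    rintro ⟨y, hy⟩
    obtain ⟨x, rfl⟩ := hf y
    exact ⟨⟨x, hy⟩, rfl⟩
  have h1 : Nat.card (H.comap f) = Nat.card φ.ker * φ.ker.index := (Subgroup.card_mul_index φ.ker).symm
  have h2 : φ.ker.index = Nat.card H := by
    rw [Subgroup.index_ker, MonoidHom.range_eq_top.mpr hφ, Subgroup.card_top]
  have h3 : Nat.card φ.ker = Nat.card f.ker := by
    refine Nat.card_congr ⟨fun x => ⟨x.1.1, by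
        have := x.2; rw [MonoidHom.mem_ker] at this ⊢; exact congrArg Subtype.val this⟩,
      fun x => ⟨⟨x.1, by
        have hx := x.2; rw [MonoidHom.mem_ker] at hx; rw [Subgroup.mem_comap, hx]; exact one_mem H⟩, by
        have hx := x.2; rw [MonoidHom.mem_ker] at hx ⊢; exact Subtype.ext hx⟩, fun _ => rfl, fun _ => rfl⟩
  rw [h1, h2, h3]

variable {S : Scheme.{0}} (A : AbelianSchemeOver S) (D : A.DualPair)

/-! ## §1 At a geometric point: `ι_s̄^*L^Δ(λ)^{⊗m} ≅ 𝒪(m • (Θ + (−1)^*Θ))` for THE `Θ` with `λ̄ = Λ(𝒪(Θ))`, and `#K` -/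

section Geometric

variable {lam : A.X ⟶ D.hat.X} {Ω : Type} [Field Ω] [IsAlgClosed Ω] (s : Spec (.of Ω) ⟶ S)
  {j : (A.fibre s).toAbelianVariety.X.left ⟶ A.X.left} {Θ : CartierDivisor (A.fibre s).toAbelianVariety.X.left}

/-- **`ι_s̄^*(L^Δ(λ)^{⊗m}) ≅ 𝒪(m • (Θ + (−1)^*Θ))`** at a geometric point with `λ̄ = Λ(𝒪(Θ))` (★ V4 §1
`detClass_restrict_LDelta_eq_cechClass_add_pullback_neg`: the classes agree; rank-one modules with equal classes are isomorphic).
[cite: MumfordFogartyKirwan1994, Ch. 6 §2 Prop. 6.10 (p. 121)] -/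
theorem nonempty_iso_restrict_LDelta_tensorPow_lineBundle_nsmul (hι : j = pullback.fst A.X.hom s) (hΛ : A.IsLambdaOfAt s D lam Θ)
    (Gr : A.X.left ⟶ A.prodLeft D.hat) (hGr₁ : Gr ≫ pullback.fst A.X.hom D.hat.X.hom = 𝟙 _)
    (hGr₂ : Gr ≫ pullback.snd A.X.hom D.hat.X.hom = lam.left) (m : ℕ) :
    Nonempty ((Scheme.Modules.pullback j).obj (tensorPow ((Scheme.Modules.pullback Gr).obj D.P) m) ≅
      lineBundle (m • (Θ + Θ.pullback (AbelianVariety.Hom.toSchemeHom (-𝟙 (A.fibre s).toAbelianVariety)))).toUnitCocycle) := by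
  have hLΔ₁ : HasRank ((Scheme.Modules.pullback Gr).obj D.P) 1 := hasRank_pullback Gr D.hasRank_one
  have hF : IsFiniteLocallyFree ((Scheme.Modules.pullback Gr).obj D.P) := HasRank.isFiniteLocallyFree' hLΔ₁
  have hcl := A.detClass_restrict_LDelta_eq_cechClass_add_pullback_neg D s hι hΛ Gr hGr₁ hGr₂ (hF.pullback j)
  refine (nonempty_iso_iff_detClass_eq (hasRank_pullback j (hasRank_tensorPow_one hLΔ₁ m))
    (UnitCocycle.hasRank_lineBundle _) ((isFiniteLocallyFree_tensorPow hF m).pullback j)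
    (UnitCocycle.isFiniteLocallyFree_lineBundle _)).2 ?_
  rw [detClass_lineBundle_toUnitCocycle, detClass_pullback _ (isFiniteLocallyFree_tensorPow hF m),
    detClass_tensorPow hLΔ₁ hF m, map_pow, ← detClass_pullback _ hF, hcl, cechClass_smul']

/-- **`#K(m • (Θ + (−1)^*Θ)) = ((2m)^g · ∏ δᵢ)²`** at a geometric point of a polarised abelian scheme of relative dimension `g` and
type `δ` over a field of characteristic `0`, `Θ` the divisor with `λ̄ = Λ(𝒪(Θ))` and `m ≥ 1`: `K(m Θ_sym) = [2m]⁻¹ K(Θ)` on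
`Ω`-points (`φ_{Θ_sym} = φ_Θ²`, ★ `phiPic_detClass_restrict_LDelta`; `φ` multiplicative), `K(Θ) = ker λ̄` (★ `mem_kerPointsAt_iff_mem_KTheta`)
has `(∏ δᵢ)²` points (★ `natCard_kerPointsAt_eq_of_hasType`), `[2m]` is onto on `Ω`-points (★ `pow_surjective_of_cast_ne_zero`) with kernel
`A_s̄[2m]` of order `(2m)^{2g}` (★ `natCard_torsionPoints_eq_of_charZero`). [cite: MumfordAV1970, §6 Application 3 (p. 64) and §23]
[cite: MumfordFogartyKirwan1994, App. 7A (pp. 234–235)] -/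
theorem natCard_KTheta_nsmul_symm_eq [CharZero Ω] (pol : A.Polarization D) {g : ℕ} (hg : A.IsOfRelDim g) {δ : Fin g → ℕ}
    (hT : pol.HasType δ) (hι : j = pullback.fst A.X.hom s) (hΛ : A.IsLambdaOfAt s D pol.lam Θ)
    (Gr : A.X.left ⟶ A.prodLeft D.hat) (hGr₁ : Gr ≫ pullback.fst A.X.hom D.hat.X.hom = 𝟙 _)
    (hGr₂ : Gr ≫ pullback.snd A.X.hom D.hat.X.hom = pol.lam.left) {m : ℕ} (hm : 0 < m) :
    Nat.card ((A.fibre s).toAbelianVariety.KTheta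
      (m • (Θ + Θ.pullback (AbelianVariety.Hom.toSchemeHom (-𝟙 (A.fibre s).toAbelianVariety))))) =
      ((2 * m) ^ g * polarizationDegree δ) ^ 2 := by
  -- notation-free abbreviations (no `set`: it would generalise `j`, `Θ` in the hypotheses)
  have hLΔ₁ : HasRank ((Scheme.Modules.pullback Gr).obj D.P) 1 := hasRank_pullback Gr D.hasRank_one
  have hF : IsFiniteLocallyFree ((Scheme.Modules.pullback Gr).obj D.P) := HasRank.isFiniteLocallyFree' hLΔ₁
  have hcl := A.detClass_restrict_LDelta_eq_cechClass_add_pullback_neg D s hι hΛ Gr hGr₁ hGr₂ (hF.pullback j)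
  -- `φ_Θ(x)^n = φ_Θ(x^n)` (`φ_Θ` is a homomorphism in the point, ★ `phiPic_mul'`)
  have hpow : ∀ (x : (A.fibre s).toAbelianVariety.Points Ω) (n : ℕ),
      phiPic (A.fibre s).toAbelianVariety Θ.cechClass x ^ n = phiPic (A.fibre s).toAbelianVariety Θ.cechClass (x ^ n) := by
    intro x n
    induction n with
    | zero => rw [pow_zero, pow_zero, phiPic_one]
    | succ n ih => rw [pow_succ, pow_succ, ih, phiPic_mul']
  -- `φ_{m Θ_sym}(x) = φ_Θ(x)^{2m} = φ_Θ(x^{2m})`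
  have hφ : ∀ x : (A.fibre s).toAbelianVariety.Points Ω,
      phiPic (A.fibre s).toAbelianVariety
          (m • (Θ + Θ.pullback (AbelianVariety.Hom.toSchemeHom (-𝟙 (A.fibre s).toAbelianVariety)))).cechClass x =
        phiPic (A.fibre s).toAbelianVariety Θ.cechClass (x ^ (2 * m)) := by
    intro x
    rw [cechClass_smul', ← hcl, ← phiPicAt_apply, map_pow, phiPicAt_apply,
      A.phiPic_detClass_restrict_LDelta D s hι hΛ Gr hGr₁ hGr₂ (hF.pullback j) x, ← pow_mul, mul_comm, hpow]
  -- `K(m Θ_sym) = [2m]⁻¹ K(Θ)`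
  have hmem : ∀ x : (A.fibre s).toAbelianVariety.Points Ω,
      x ∈ (A.fibre s).toAbelianVariety.KTheta
          (m • (Θ + Θ.pullback (AbelianVariety.Hom.toSchemeHom (-𝟙 (A.fibre s).toAbelianVariety)))) ↔
        x ^ (2 * m) ∈ (A.fibre s).toAbelianVariety.KTheta Θ := by
    intro x
    rw [AbelianVariety.mem_KTheta_iff', AbelianVariety.mem_KTheta_iff', ← CartierDivisor.cechClass_eq_iff_linEquiv,
      ← CartierDivisor.cechClass_eq_iff_linEquiv, CartierDivisor.cechClass_pullback, CartierDivisor.cechClass_pullback,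
      ← phiPic_eq_one_iff, ← phiPic_eq_one_iff, hφ]
  have hcomap : (A.fibre s).toAbelianVariety.KTheta
      (m • (Θ + Θ.pullback (AbelianVariety.Hom.toSchemeHom (-𝟙 (A.fibre s).toAbelianVariety)))) =
      ((A.fibre s).toAbelianVariety.KTheta Θ).comap (powMonoidHom (2 * m)) := by
    ext x; rw [Subgroup.mem_comap]; exact hmem x
  -- count
  have h2m0 : 2 * m ≠ 0 := Nat.mul_ne_zero_iff.mpr ⟨two_ne_zero, hm.ne'⟩
  have h2m : ((2 * m : ℕ) : Ω) ≠ 0 := by exact_mod_cast h2m0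
  have hsurj : Surjective (powMonoidHom (2 * m) :
      (A.fibre s).toAbelianVariety.Points Ω →* (A.fibre s).toAbelianVariety.Points Ω) :=
    (A.fibre s).toAbelianVariety.pow_surjective_of_cast_ne_zero h2m
  have hker : Nat.card (powMonoidHom (2 * m) :
      (A.fibre s).toAbelianVariety.Points Ω →* (A.fibre s).toAbelianVariety.Points Ω).ker = (2 * m) ^ (2 * g) := by
    rw [← A.dim_fibre_of_isOfRelDim hg s, ← (A.fibre s).toAbelianVariety.natCard_torsionPoints_eq_of_charZero Ω (2 * m) h2m0]
    refine Nat.card_congr (Equiv.subtypeEquivRight fun x => ?_)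
    rw [MonoidHom.mem_ker, AbelianVariety.mem_torsionPoints_iff, powMonoidHom_apply, zpow_natCast]
  have hK : Nat.card ((A.fibre s).toAbelianVariety.KTheta Θ) = polarizationDegree δ ^ 2 := by
    rw [← pol.natCard_kerPointsAt_eq_of_hasType hT Ω s]
    exact Nat.card_congr (Equiv.subtypeEquivRight fun P => (pol.mem_kerPointsAt_iff_mem_KTheta s hΛ P).symm)
  rw [hcomap, natCard_comap_eq_mul _ hsurj, hker, hK]
  ring

/-! ## §2 The geometric consumer form: `dim_Ω Γ(A_s̄, ι_s̄^*L^Δ(λ)^{⊗m}) = (2m)^g · ∏ δᵢ` -/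

/-- `dim_L Γ(Y, G)` through `ρ ∘ ΓSpecIso⁻¹ : L → Γ(Y, 𝒪)` equals `dim_{Γ(Spec L, 𝒪)} Γ(Y, G)` through `ρ` (the two scalar rings are
identified by `ΓSpecIso`). [folklore] -/
private theorem finrank_secMod_comp_ΓSpecIso_inv {L : Type} [Field L] {Y : Scheme.{0}} (ρ : Γ(Spec (.of L), ⊤) →+* Γ(Y, ⊤))
    (G : Y.Modules) :
    Module.finrank L (SecMod G (ρ.comp (Scheme.ΓSpecIso (.of L)).inv.hom) ⊤) = Module.finrank Γ(Spec (.of L), ⊤) (SecMod G ρ ⊤) := by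
  refine congrArg Cardinal.toNat (rank_eq_of_equiv_equiv (Scheme.ΓSpecIso (.of L)).inv
    (AddEquiv.refl _) (Scheme.ΓSpecIso (.of L)).symm.commRingCatIsoToRingEquiv.bijective fun c m => ?_)
  rfl

/-- **RANK of `L^Δ(λ)^{⊗m}` on a geometric fibre: `dim_Ω Γ(A_s̄, ι_s̄^*L^Δ(λ)^{⊗m}) = (2m)^g · ∏ δᵢ`** for a polarised abelian scheme
of relative dimension `g` and type `δ`, a geometric point `s̄ : Spec Ω → S` with `Ω` algebraically closed of characteristic `0`, the fibre
inclusion `j = ι_s̄` (`hι`) and `m ≥ 1` (`m = 3`: `6^g ∏ δᵢ`, the projective embedding dimension `+1` of [MumfordFogartyKirwan1994] Prop. 6.13 /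
Def. 7.3).  Proof: `ι_s̄^*L^Δ(λ)^{⊗m} ≅ 𝒪(m Θ_sym)` (§1) with `Θ_sym = Θ + (−1)^*Θ` ample, `h⁰(m Θ_sym)² = #K(m Θ_sym)` (★
`h0_sq_eq_natCard_KTheta_of_isAlgClosed`: Mumford §16, transported from `ℂ`) `= ((2m)^g ∏ δᵢ)²` (§1), square root.
[cite: MumfordFogartyKirwan1994, Ch. 6 §2 Prop. 6.13 (p. 123)] [cite: MumfordAV1970, §16 (the Riemann–Roch theorem)] -/
theorem Polarization.finrank_secMod_restrict_LDelta_tensorPow [CharZero Ω] (pol : A.Polarization D) {g : ℕ}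
    (hg : A.IsOfRelDim g) {δ : Fin g → ℕ} (hT : pol.HasType δ) (hι : j = pullback.fst A.X.hom s)
    (Gr : A.X.left ⟶ A.prodLeft D.hat) (hGr₁ : Gr ≫ pullback.fst A.X.hom D.hat.X.hom = 𝟙 _)
    (hGr₂ : Gr ≫ pullback.snd A.X.hom D.hat.X.hom = pol.lam.left) {m : ℕ} (hm : 0 < m) :
    Module.finrank Ω (SecMod ((Scheme.Modules.pullback j).obj (tensorPow ((Scheme.Modules.pullback Gr).obj D.P) m))
        ((A.fibre s).toAbelianVariety.X.hom.appTop.hom.comp (Scheme.ΓSpecIso (.of Ω)).inv.hom) ⊤) =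
      (2 * m) ^ g * polarizationDegree δ := by
  obtain ⟨Θ, hΘ, hΛ⟩ := pol.exists_ample Ω s
  -- `ι^*L^{⊗m} ≅ 𝒪(m Θ_sym)`, so the two section spaces have the same dimension, `= h⁰(m Θ_sym)`
  obtain ⟨e⟩ := A.nonempty_iso_restrict_LDelta_tensorPow_lineBundle_nsmul D s hι hΛ Gr hGr₁ hGr₂ m
  obtain ⟨Lin, -⟩ := exists_secMod_linearEquiv_of_iso
    ((A.fibre s).toAbelianVariety.X.hom.appTop.hom.comp (Scheme.ΓSpecIso (.of Ω)).inv.hom) e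
  rw [Lin.finrank_eq, CartierDivisor.finrank_secMod_lineBundle_eq_h0 (A.fibre s).toAbelianVariety.X]
  -- `Θ_sym` and `m Θ_sym` are ample
  let ν : (A.fibre s).toAbelianVariety.X.left ⟶ (A.fibre s).toAbelianVariety.X.left :=
    AbelianVariety.Hom.toSchemeHom (-𝟙 (A.fibre s).toAbelianVariety)
  have hνν : ν ≫ ν = 𝟙 _ := by
    change AbelianVariety.Hom.toSchemeHom ((-𝟙 _) ≫ (-𝟙 _)) = 𝟙 _
    rw [Preadditive.neg_comp_neg, Category.comp_id]
    rfl
  haveI : IsIso ν := ⟨ν, hνν, hνν⟩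
  have hamp : (m • (Θ + Θ.pullback ν)).IsAmple := (hΘ.add (hΘ.pullback ν)).smul hm
  -- `h⁰² = #K = ((2m)^g ∏δᵢ)²`
  have hsq := AbelianVariety.h0_sq_eq_natCard_KTheta_of_isAlgClosed (A.fibre s).toAbelianVariety _ hamp
  rw [A.natCard_KTheta_nsmul_symm_eq D s pol hg hT hι hΛ Gr hGr₁ hGr₂ hm] at hsq
  exact Nat.pow_left_injective two_ne_zero hsq

/-- The same over the scalar ring `Γ(Spec Ω, 𝒪)` (structure map `g♯` of the fibre), the currency of the (h2) sockets.
[cite: MumfordFogartyKirwan1994, Ch. 6 §2 Prop. 6.13 (p. 123)] -/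
theorem Polarization.finrank_secMod_restrict_LDelta_tensorPow' [CharZero Ω] (pol : A.Polarization D) {g : ℕ}
    (hg : A.IsOfRelDim g) {δ : Fin g → ℕ} (hT : pol.HasType δ) (hι : j = pullback.fst A.X.hom s)
    (Gr : A.X.left ⟶ A.prodLeft D.hat) (hGr₁ : Gr ≫ pullback.fst A.X.hom D.hat.X.hom = 𝟙 _)
    (hGr₂ : Gr ≫ pullback.snd A.X.hom D.hat.X.hom = pol.lam.left) {m : ℕ} (hm : 0 < m) :
    Module.finrank Γ(Spec (.of Ω), ⊤) (SecMod ((Scheme.Modules.pullback j).obj (tensorPow ((Scheme.Modules.pullback Gr).obj D.P) m))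
        (A.fibre s).toAbelianVariety.X.hom.appTop.hom ⊤) = (2 * m) ^ g * polarizationDegree δ := by
  rw [← finrank_secMod_comp_ΓSpecIso_inv]
  exact pol.finrank_secMod_restrict_LDelta_tensorPow A D s hg hT hι Gr hGr₁ hGr₂ hm

end Geometric

/-! ## §3 The consumer's `hrank`: every field-valued point, any cartesian presentation of the fibre -/

section AnyPoint

/-- **`hrank` for the F-6 (VI) assembler: `dim_{κ(t)} Γ(X₀, L^Δ(λ)^{⊗m}|_{X₀}) = (2m)^g · ∏ δᵢ` at EVERY field-valued point `t : Spec κ → S`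
of a base of characteristic `0`, in ANY cartesian presentation `X₀ = A ×_S Spec κ`** (scalars `Γ(Spec κ, 𝒪)`, sections `SecMod … f₀♯ ⊤` — the
binder of ★ `Morphisms/SectionsRankOfFibreVanishing.rankAtStalk_secMod_top_eq_of_forall_prime`, B-p04 (g20)): the geometric fibre over
`κ̄` maps to `X₀` by a cartesian square over `Spec κ̄ → Spec κ` (pasting), §2 upstairs, and flat base change of `H⁰` down (★
`Modules.finrank_secMod_top_eq_of_isPullback_specMap`, [GortzWedhorn2023] Cor. 22.91).  With the companion `hvan` ★
`Polarization.subsingleton_ext_one_pullback_LDelta_tensorPow'` this is F-2 (b)'s field case as the F-6 (VI) assembler reads it.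
[cite: MumfordFogartyKirwan1994, Ch. 6 §2 Prop. 6.13 (p. 123)] [cite: MumfordAV1970, §16 (the Riemann–Roch theorem)]
[cite: GortzWedhorn2023, Cor. 22.91 (p. 278)] -/
theorem Polarization.finrank_secMod_pullback_LDelta_tensorPow (pol : A.Polarization D) {g : ℕ} (hg : A.IsOfRelDim g)
    {δ : Fin g → ℕ} (hT : pol.HasType δ)
    (Gr : A.X.left ⟶ A.prodLeft D.hat) (hGr₁ : Gr ≫ pullback.fst A.X.hom D.hat.X.hom = 𝟙 _)
    (hGr₂ : Gr ≫ pullback.snd A.X.hom D.hat.X.hom = pol.lam.left)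
    {κ : Type} [Field κ] [CharZero κ] (t : Spec (.of κ) ⟶ S) {X₀ : Scheme.{0}} {iX : X₀ ⟶ A.X.left}
    {f₀ : X₀ ⟶ Spec (.of κ)} (H : IsPullback iX f₀ A.X.hom t) {m : ℕ} (hm : 0 < m) :
    Module.finrank Γ(Spec (.of κ), ⊤)
        (SecMod ((Scheme.Modules.pullback iX).obj (tensorPow ((Scheme.Modules.pullback Gr).obj D.P) m)) f₀.appTop.hom ⊤) =
      (2 * m) ^ g * polarizationDegree δ := by
  -- the geometric point `s̄ : Spec κ̄ → Spec κ → S`, its fibre, and the cartesian square over `Spec κ̄ → Spec κ`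
  let φ : κ →+* AlgebraicClosure κ := algebraMap κ (AlgebraicClosure κ)
  let s : Spec (.of (AlgebraicClosure κ)) ⟶ S := Spec.map (CommRingCat.ofHom φ) ≫ t
  let g' : (A.fibre s).toAbelianVariety.X.left ⟶ Spec (.of (AlgebraicClosure κ)) := pullback.snd A.X.hom s
  have hbig : IsPullback (pullback.fst A.X.hom s) g' A.X.hom (Spec.map (CommRingCat.ofHom φ) ≫ t) :=
    IsPullback.of_hasPullback A.X.hom s
  let k' : (A.fibre s).toAbelianVariety.X.left ⟶ X₀ :=
    H.lift (pullback.fst A.X.hom s) (g' ≫ Spec.map (CommRingCat.ofHom φ)) (by rw [Category.assoc]; exact hbig.w)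
  have hk₁ : k' ≫ iX = pullback.fst A.X.hom s := H.lift_fst _ _ _
  have hk₂ : k' ≫ f₀ = g' ≫ Spec.map (CommRingCat.ofHom φ) := H.lift_snd _ _ _
  have hsq : IsPullback k' g' f₀ (Spec.map (CommRingCat.ofHom φ)) :=
    IsPullback.of_right (by rw [hk₁]; exact hbig) hk₂ H
  -- the module is affine-localizing; `f₀` is proper
  let E : A.X.left.Modules := tensorPow ((Scheme.Modules.pullback Gr).obj D.P) m
  have hE : IsFiniteLocallyFree E :=
    isFiniteLocallyFree_tensorPow (HasRank.isFiniteLocallyFree' (hasRank_pullback Gr D.hasRank_one)) m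
  have hG : IsAffineLocalizing ((Scheme.Modules.pullback iX).obj E) := by
    haveI := (hE.pullback iX).isVectorBundle.1
    exact IsAffineLocalizing.of_isQuasicoherent _
  haveI : IsProper A.X.hom := A.isProper
  haveI : IsProper f₀ := MorphismProperty.of_isPullback H inferInstance
  haveI : CharZero (AlgebraicClosure κ) := (RingHom.charZero_iff φ.injective).mp inferInstance
  -- down: flat base change of `H⁰` along `κ → κ̄`
  rw [← finrank_secMod_top_eq_of_isPullback_specMap φ hsq ((Scheme.Modules.pullback iX).obj E) hG]
  -- upstairs: `k'^* iX^* E ≅ (k' ≫ iX)^* E = ι_s̄^* E`, then §2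
  obtain ⟨Lin, -⟩ := exists_secMod_linearEquiv_of_iso
    (M := (Scheme.Modules.pullback k').obj ((Scheme.Modules.pullback iX).obj E))
    (N := (Scheme.Modules.pullback (k' ≫ iX)).obj E) g'.appTop.hom ((Scheme.Modules.pullbackComp k' iX).app E)
  rw [Lin.finrank_eq]
  exact pol.finrank_secMod_restrict_LDelta_tensorPow' A D s hg hT hk₁ Gr hGr₁ hGr₂ hm

end AnyPoint

end AbelianSchemeOver

end Literature.AlgebraicGeometry.AbelianSchemes
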